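import Mathlib
import Literature.NumberTheory.LFunctions.Zhang2022.Section2Lemma23Holds
import Literature.NumberTheory.LFunctions.Zhang2022.DetectorTemplate
import Literature.NumberTheory.LFunctions.Zhang2022.DetectorShiftAdmissible
import HarnessLib

/-!
# Zhang (2022), programme F-S3 (cell landau-siegel, family B-det): the SIGN LEMMA of a general shift detector —
# «SignLemma_S»: Proposition 2.2 ⇒ `𝔠*_S(ρ,ψ) ≥ 0` for every ROBUSTLY sign-admissible shift datum `S`, PROVED

Topic `Literature/NumberTheory/LFunctions/Zhang2022` (Landau–Siegel audit tree; verdict-neutral).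
Y. Zhang, *Discrete mean estimates and the Landau–Siegel zero*, arXiv:2211.02515v1 [Zhang2022LandauSiegel] —
an unrefereed manuscript under adjudication. **WHAT THIS IS NOT: not a claim about Theorems 1–2 of
arXiv:2211.02515, about Landau–Siegel zeros, or about Parity; nothing here asserts any claim of the manuscript
(everything is conditional on its Proposition 2.2, a CLAIM node `Skeleton.Prop22 c′` of the typed skeleton).**
«The programme SEARCHES and TYPES; no claim about Landau–Siegel zeros, Theorems 1–2 of arXiv:2211.02515 or a
repaired Margin232 until a kernel theorem says so.»

## What is here (cell registry row «SignLemma_S», REF-B2 e1 on `B-det/EDLIST.md` v1; family W2 = shift detectors)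

A W2 design replaces the printed shifts `β = (iα(1−5c′α𝓛), 2iα(1+c′α𝓛), 3iα(1−c′α𝓛))` (2.13) by a general datum
`S = (b, e)`, `β_j = ib_jα(1 + e_jc′α𝓛)` (`DetTemplate.ShiftData`, weight `DetTemplate.cstarS S c′` =
`−iΠ_jM(ρ+β_j)/M′(ρ)`, detector `DetTemplate.shiftDetector S c′`). Every «decided: (B1)» word for such a design
(exact Cauchy–Schwarz of a non-negatively weighted discrete form, `Det.norm_sq_discreteForm_le` /
`DetTemplate.Detector.Positive.cauchySchwarz`) needs the SIGN LEMMA of the design: `𝔠*_S(ρ,ψ) ≥ 0` at every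
sampled zero. In print this is Lemma 2.3, stated and proved (pp. 11–12, from Proposition 2.2) ONLY at
`b = (1,2,3)`; the tree has that proof kernel-checked (`Skeleton.ded23_holds`, `Section2Lemma23Holds.lean`). This
file runs the same proof for a general datum:

* `Det.im_gt_of_gap_nat` — Prop. 2.2 (iii) iterated: under consecutive gaps `a ± e`, NO zero of `L(s,ψ)L(s,ψχ)` has
  height in the shrunk `k`-th gap `[γ + k(a+e), γ + (k+1)(a−e)]` above a zero `½+iγ` (induction on `k`; the tree's
  `im_gt_of_gap_three` is `k = 2`); `LFunction_half_ne_zero_of_gap_nat`, `Mfun_half_ne_zero_of_gap_nat`;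
* `Det.M_signs_of_prop22_heights` — the two sign steps ("`M(ρ+β₂)M(ρ+β₃) > 0` by the mean-value theorem",
  "`M(ρ+β₁)/(iM′(ρ)) = lim_{v→0⁺} … ≥ 0`") for shifts at ABSTRACT heights `0 < v₀ ≤ α − c′α²𝓛` and
  `0 < v₁ ≤ v₂` inside one shrunk gap, re-using the tree's real-variable lemmas verbatim;
* `Det.shiftHeight`, `Det.cstarS_eq_mul`, `Det.cstarS_nonneg_of_prop22_heights` — `𝔠*_S = [M(ρ+β₀)/(iM′)]·[M(ρ+β₁)M(ρ+β₂)]`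
  real and `≥ 0` when the heights sit in the pattern;
* `Det.SignRobust S` — the hypothesis on the DATA: `Det.SignAdmissible S.b` (sorted, `b₀ ≤ 1`, pair in one gap
  `[k, k+1]`, `DetectorShiftAdmissible.lean`) AND, for main values ON the fence (integers), first-order corrections
  pushing the shift into the right gap by at least the accumulated gap error: `b₀ ∈ ℤ ⇒ e₀ ≤ −1`, `b₁ ∈ ℤ ⇒ e₁ ≥ 1`,
  `b₂ ∈ ℤ ⇒ e₂ ≤ −1` — exactly what (2.13)'s `e = (−5, 1, −1)` does (`signRobust_zhangShift`; the bare main values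
  `(1,2,3)` with `e = 0` are NOT robust, `not_signRobust_std_uncorrected`); off-lattice values need nothing
  (`signRobust_offLattice`); `SignRobust.exists_threshold` / `exists_alpha_threshold` /
  `SignRobust.exists_heights_threshold` — "for `D` sufficiently large" made explicit (`α = π/𝓛⁹ → 0`,
  `c′α𝓛 = c′π/𝓛⁸ → 0`);
* the row itself `Det.SignLemmaS S c′` (= `Skeleton.Lemma23 c′` at `S = zhangShift`, `signLemmaS_zhangShift_iff`),
  its deduction node `Det.DedSignLemmaS S c′ := Prop22 c′ → SignLemmaS S c′` (= `Skeleton.Ded23 c′` there), and the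
  DISCHARGE **`Det.signLemmaS_of_prop22` / `Det.dedSignLemmaS_holds`: `SignRobust S → 0 ≤ c′ → (Prop22 c′ →
  SignLemmaS S c′)`**, with the detector-level corollaries `Det.positive_shiftDetector :
  SignRobust S → 0 ≤ c′ → Prop22 c′ → (shiftDetector S c′).Positive` and `Det.ineq216_shiftDetector` ((2.16) for
  the `S`-detector), and the consistency check `positive_zhang_of_prop22` (the printed detector along the general
  route).

* `Det.signRobust_of_signAdmissible` — the canonical corrections `e = (−1, 1, −1)` make every sign-admissible
  triple of main values robust; `signLemmaS_of_signAdmissible`, `positive_shiftDetector_of_signAdmissible`.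

REGISTRY CONSEQUENCE (stated here only as bookkeeping, decided by the cell's planner/referee): for a ROBUST W2 design
the row «SignLemma_S» has the standing of the printed Lemma 2.3 itself — a theorem GIVEN `Prop22 c′` — not
«derivation (in-house)». No new named facts; no hypotheses beyond `Prop22 c′`; imports Literature/Mathlib only.

## References

* Y. Zhang, arXiv:2211.02515v1 (2022), §2: (2.11)–(2.16), Proposition 2.2 and its restatement p. 7, Lemma 2.3
  p. 5 and its proof pp. 11–12. [cite: Zhang2022LandauSiegel, §2 Lemma 2.3 (proof) pp. 11–12]
-/

noncomputable section

open Complex Real Filter Topology Set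

namespace Literature.NumberTheory.LFunctions.Zhang2022

open Skeleton DetTemplate

namespace Det

/-! ### Part 1 — consecutive zeros: the `k`-th gap above `ρ` (Prop. 2.2 (iii) iterated) -/

/-- **The restated gap assertion iterated `k+1` steps** (p. 7 "`|γ′ − γ − α| < c′α²𝓛`" for consecutive zeros):
in a finite set `S ⊆ ℂ` whose consecutive heights differ by `a ± e` (`a + e ≥ 0`), a point `z ∈ S` above
`s ∈ S` with `Im z ≥ Im s + k(a+e)` already has `Im z > Im s + (k+1)(a−e)` — i.e. NO point of `S` has height in
`[Im s + k(a+e), Im s + (k+1)(a−e)]` (the `k`-th fence gap above `s`, shrunk by the accumulated error; `k = 0`: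
`(Im s, Im s + a − e]`, `k = 2`: the printed range `|β₂| ≤ v ≤ |β₃|` of the proof of Lemma 2.3).
[cite: Zhang2022LandauSiegel, §2 Prop. 2.2 (iii) p. 7; proof of Lemma 2.3 p. 11] -/
theorem im_gt_of_gap_nat {S : Set ℂ} (hS : S.Finite) {a e : ℝ} (hae : 0 ≤ a + e)
    (hgap : ∀ s ∈ S, ∀ s' ∈ S, s.im < s'.im →
      (∀ s'' ∈ S, ¬ (s.im < s''.im ∧ s''.im < s'.im)) → |s'.im - s.im - a| < e) :
    ∀ (k : ℕ) {s z : ℂ}, s ∈ S → z ∈ S → s.im < z.im → s.im + k * (a + e) ≤ z.im →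
      s.im + (k + 1) * (a - e) < z.im := by
  intro k
  induction k with
  | zero =>
    intro s z hs hz hsz _
    have h := im_gt_of_gap hS hgap hs hz hsz
    push_cast
    linarith
  | succ k ih =>
    intro s z hs hz hsz hk
    push_cast at hk ⊢
    obtain ⟨w, hw, h1l, h1u, -⟩ := exists_next_above_gap hS hgap hs hz hsz
    have hk0 : 0 ≤ (k : ℝ) * (a + e) := mul_nonneg k.cast_nonneg hae
    have hwz : w.im < z.im := by linarith
    have h := ih hw hz hwz (by linarith)
    linarith

section Setting

variable {D : ℕ} [NeZero D] (χ : DirichletCharacter ℂ D)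

omit [NeZero D] in
/-- `Im(½ + iu) = u`. [folklore] -/
private theorem im_half_add_mul_I (u : ℝ) : ((1 : ℂ) / 2 + u * I).im = u := by simp

/-- **The zero-free ranges above a product zero, every gap** (p. 11, generalised from the printed
`0 < v ≤ |β₁|`, `|β₂| ≤ v ≤ |β₃|`): if the zeros of `L(s,ψ)L(s,ψχ)` in `Ω` form a finite set `∋ ρ` with consecutive
heights `a ± e` apart (`a + e ≥ 0`), then `L(½+iu,ψ) ≠ 0` whenever `u > Im ρ`, `½+iu ∈ Ω` and
`Im ρ + k(a+e) ≤ u ≤ Im ρ + (k+1)(a−e)` for some `k ∈ ℕ`. [cite: Zhang2022LandauSiegel, §2 proof of Lemma 2.3 p. 11] -/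
theorem LFunction_half_ne_zero_of_gap_nat {x : Chr D} (hfin : (prodZeroSetOmega χ x).Finite)
    {a e : ℝ} (hae : 0 ≤ a + e)
    (hgap : ∀ s ∈ prodZeroSetOmega χ x, ∀ s' ∈ prodZeroSetOmega χ x, s.im < s'.im →
      (∀ s'' ∈ prodZeroSetOmega χ x, ¬ (s.im < s''.im ∧ s''.im < s'.im)) →
        |s'.im - s.im - a| < e)
    {ρ : ℂ} (hρS : ρ ∈ prodZeroSetOmega χ x) {u : ℝ} (hΩ : (1 : ℂ) / 2 + u * I ∈ Omega D)
    (hu0 : ρ.im < u) {k : ℕ} (hk : ρ.im + k * (a + e) ≤ u ∧ u ≤ ρ.im + (k + 1) * (a - e)) :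
    x.ψ.LFunction ((1 : ℂ) / 2 + u * I) ≠ 0 := by
  intro h0
  have hz : (1 : ℂ) / 2 + u * I ∈ prodZeroSetOmega χ x := ⟨hΩ, by rw [h0, zero_mul]⟩
  have h := im_gt_of_gap_nat hfin hae hgap k hρS hz (by rw [im_half_add_mul_I]; exact hu0)
    (by rw [im_half_add_mul_I]; exact hk.1)
  rw [im_half_add_mul_I] at h
  linarith [hk.2]

/-- **"`M(ρ+iv,ψ) ≠ 0`" on every shrunk fence gap above `ρ ∈ 𝔷(ψ)`**, from Proposition 2.2 (iii) at one
character (`a = α`, `e = c′α²𝓛`, `c′ ≥ 0`): for `D ≥ 3`, `χ` primitive, `ρ = ½+iγ ∈ 𝔷(ψ)` and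
`γ < u < γ + 2` with `γ + k(α + c′α²𝓛) ≤ u ≤ γ + (k+1)(α − c′α²𝓛)`: `M(½+iu,ψ) ≠ 0`.
[cite: Zhang2022LandauSiegel, §2 proof of Lemma 2.3 p. 11] -/
theorem Mfun_half_ne_zero_of_gap_nat (hD : 3 ≤ D) (hχ : χ.IsPrimitive) {c' : ℝ} (hc' : 0 ≤ c')
    (x : Chr D)
    (h_iii : ∀ s ∈ prodZeroSetOmega χ x, ∀ s' ∈ prodZeroSetOmega χ x, s.im < s'.im →
      (∀ s'' ∈ prodZeroSetOmega χ x, ¬ (s.im < s''.im ∧ s''.im < s'.im)) →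
        |s'.im - s.im - alpha D| < c' * alpha D ^ 2 * ell D)
    {ρ : ℂ} (hρ : ρ ∈ zeroSet D x) {u : ℝ} (hu0 : ρ.im < u) (hu2 : u < ρ.im + 2) {k : ℕ}
    (hk : ρ.im + k * (alpha D + c' * alpha D ^ 2 * ell D) ≤ u ∧
      u ≤ ρ.im + (k + 1) * (alpha D - c' * alpha D ^ 2 * ell D)) :
    Mfun x.ψ ((1 : ℂ) / 2 + u * I) ≠ 0 := by
  have hρS : ρ ∈ prodZeroSetOmega χ x := mem_prodZeroSetOmega_of_mem_zeroSet χ x hρ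
  have hγ : 0 < ρ.im := im_pos_of_mem_zeroSet hD hρ
  have hℓ : 1 < ell D := one_lt_ell hD
  have hα : 0 < alpha D := by
    rw [alpha, bigP, Real.log_exp]; exact div_pos Real.pi_pos (pow_pos (by linarith) _)
  have hae : 0 ≤ alpha D + c' * alpha D ^ 2 * ell D := by positivity
  have hL : x.ψ.LFunction ((1 : ℂ) / 2 + u * I) ≠ 0 :=
    LFunction_half_ne_zero_of_gap_nat χ (prodZeroSetOmega_finite χ hD hχ x) hae h_iii hρS
      (half_add_mem_Omega hρ hu0.le hu2) hu0 hk
  exact Mfun_ne_zero x (by simpa using lt_trans hγ hu0) hL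

/-! ### Part 2 — the two sign statements of the proof of Lemma 2.3 at one zero, for shifts at ABSTRACT heights -/

/-- **The two sign steps of the proof of Lemma 2.3 for shifts at general heights** (pp. 11–12): for `D ≥ 3`,
`χ` primitive, `c′ ≥ 0`, if the zeros of `L(s,ψ)L(s,ψχ)` in `Ω` lie on the critical line (i), are simple (ii)
and have consecutive gaps `α ± c′α²𝓛` (iii), then at every `ρ = ½ + iγ ∈ 𝔷(ψ)`, for heights
`0 < v₀ ≤ α − c′α²𝓛` (below the first fence zero) and `0 < v₁ ≤ v₂` inside ONE shrunk gap
`[k(α + c′α²𝓛), (k+1)(α − c′α²𝓛)]` (all `< 2`): `M(½+i(γ+v₀))/(iM′(ρ))` and `M(½+i(γ+v₁))·M(½+i(γ+v₂))`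
are positive reals ("by the mean-value theorem", "`lim_{v→0⁺}`": the tree's `mul_pos_of_hasDerivAt_of_ne_zero`,
`mul_pos_of_continuousOn_of_ne_zero`). [cite: Zhang2022LandauSiegel, §2 proof of Lemma 2.3 pp. 11–12] -/
theorem M_signs_of_prop22_heights (hD : 3 ≤ D) (hχ : χ.IsPrimitive) {c' : ℝ} (hc' : 0 ≤ c') (x : Chr D)
    (h_i : ∀ s ∈ prodZeroSetOmega χ x, s.re = 1 / 2)
    (h_ii : ∀ s ∈ prodZeroSetOmega χ x,
      deriv (fun w => x.ψ.LFunction w * (psiChi χ x).LFunction w) s ≠ 0)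
    (h_iii : ∀ s ∈ prodZeroSetOmega χ x, ∀ s' ∈ prodZeroSetOmega χ x, s.im < s'.im →
      (∀ s'' ∈ prodZeroSetOmega χ x, ¬ (s.im < s''.im ∧ s''.im < s'.im)) →
        |s'.im - s.im - alpha D| < c' * alpha D ^ 2 * ell D)
    {ρ : ℂ} (hρ : ρ ∈ zeroSet D x) {v₀ v₁ v₂ : ℝ} {k : ℕ}
    (hv₀ : 0 < v₀) (hv₀' : v₀ ≤ alpha D - c' * alpha D ^ 2 * ell D) (hv₀2 : v₀ < 2)
    (hv₁ : 0 < v₁) (hk₁ : k * (alpha D + c' * alpha D ^ 2 * ell D) ≤ v₁) (hv₁₂ : v₁ ≤ v₂)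
    (hk₂ : v₂ ≤ (k + 1) * (alpha D - c' * alpha D ^ 2 * ell D)) (hv₂2 : v₂ < 2) :
    ((Mfun x.ψ ((1 : ℂ) / 2 + ((ρ.im + v₀ : ℝ) : ℂ) * I) / (I * deriv (Mfun x.ψ) ρ)).im = 0 ∧
      0 < (Mfun x.ψ ((1 : ℂ) / 2 + ((ρ.im + v₀ : ℝ) : ℂ) * I) / (I * deriv (Mfun x.ψ) ρ)).re) ∧
    ((Mfun x.ψ ((1 : ℂ) / 2 + ((ρ.im + v₁ : ℝ) : ℂ) * I) *
        Mfun x.ψ ((1 : ℂ) / 2 + ((ρ.im + v₂ : ℝ) : ℂ) * I)).im = 0 ∧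
      0 < (Mfun x.ψ ((1 : ℂ) / 2 + ((ρ.im + v₁ : ℝ) : ℂ) * I) *
        Mfun x.ψ ((1 : ℂ) / 2 + ((ρ.im + v₂ : ℝ) : ℂ) * I)).re) := by
  -- the data at `ρ`
  have hρS : ρ ∈ prodZeroSetOmega χ x := mem_prodZeroSetOmega_of_mem_zeroSet χ x hρ
  have hγ : 0 < ρ.im := im_pos_of_mem_zeroSet hD hρ
  have hre : ρ.re = 1 / 2 := h_i ρ hρS
  have hρeq : ρ = (1 : ℂ) / 2 + (ρ.im : ℂ) * I := Complex.ext (by simp [hre]) (by simp)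
  have hL0 : x.ψ.LFunction ρ = 0 := hρ.2.2
  -- the real function `m(u) = M(½+iu,ψ)` and its zeros
  set m : ℝ → ℝ := fun u => (Mfun x.ψ ((1 : ℂ) / 2 + u * I)).re with hm_def
  have hm0 : m ρ.im = 0 := by
    simp only [hm_def]
    rw [← hρeq, show Mfun x.ψ ρ = Yroot x.ψ ρ * x.ψ.LFunction ρ from rfl, hL0, mul_zero,
      Complex.zero_re]
  have hmne : ∀ u : ℝ, ((ρ.im < u ∧ u ≤ ρ.im + v₀) ∨ (ρ.im + v₁ ≤ u ∧ u ≤ ρ.im + v₂)) → m u ≠ 0 := by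
    intro u hu hmu
    have hu0 : ρ.im < u := by rcases hu with ⟨h, -⟩ | ⟨h, -⟩ <;> linarith
    have hu2 : u < ρ.im + 2 := by rcases hu with ⟨-, h⟩ | ⟨-, h⟩ <;> linarith
    have hupos : 0 < u := lt_trans hγ hu0
    have hne : Mfun x.ψ ((1 : ℂ) / 2 + u * I) ≠ 0 := by
      rcases hu with ⟨h1, h2⟩ | ⟨h1, h2⟩
      · exact Mfun_half_ne_zero_of_gap_nat χ hD hχ hc' x h_iii hρ hu0 hu2 (k := 0)
          ⟨by push_cast; linarith, by push_cast; linarith⟩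
      · exact Mfun_half_ne_zero_of_gap_nat χ hD hχ hc' x h_iii hρ hu0 hu2 (k := k)
          ⟨by linarith, by linarith⟩
    apply hne
    rw [Mfun_half_eq_ofReal x hupos]
    simp only [hm_def] at hmu
    rw [hmu, Complex.ofReal_zero]
  -- the derivative at `γ = Im ρ`: `m′(γ) = r = iM′(ρ)` real and non-zero
  obtain ⟨hderiv, hIim⟩ := hasDerivAt_Mfun_half_re x hγ
  rw [← hρeq] at hderiv hIim
  set d : ℂ := deriv (Mfun x.ψ) ρ with hd_def
  set r : ℝ := (I * d).re with hr_def
  have hId : I * d = (r : ℂ) := Complex.ext (by simp [hr_def]) (by rw [hIim, Complex.ofReal_im])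
  have hd0 : d ≠ 0 := by
    have hL1 := deriv_LFunction_ne_zero_of_deriv_LL_ne_zero χ hD hχ x hL0 (h_ii ρ hρS)
    exact GammaFactor.deriv_M_ne_zero_of_simple_zero x.prim x.p_ne_one (Yroot_spec x.prim).1
      (Yroot_spec x.prim).2 hγ hL0 hL1
  have hr0 : r ≠ 0 := by
    intro h
    rw [h, Complex.ofReal_zero] at hId
    exact (mul_ne_zero I_ne_zero hd0) hId
  -- **"`M(ρ+β₁,ψ)/(iM′(ρ,ψ)) ≥ 0`"**: `r · m(γ + v₀) > 0`
  have hsign₀ : 0 < r * m (ρ.im + v₀) :=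
    mul_pos_of_hasDerivAt_of_ne_zero (by linarith) (continuousOn_Mfun_half_re x hγ)
      (fun u hu => hmne u (Or.inl ⟨hu.1, hu.2⟩)) hm0 hderiv hr0
  -- **"`M(ρ+β₂,ψ)M(ρ+β₃,ψ) > 0`"**
  have hsign₁₂ : 0 < m (ρ.im + v₁) * m (ρ.im + v₂) :=
    mul_pos_of_continuousOn_of_ne_zero (by linarith) (continuousOn_Mfun_half_re x (by linarith))
      (fun u hu => hmne u (Or.inr ⟨hu.1, hu.2⟩))
  -- the values as real numbers
  have hM₀ : Mfun x.ψ ((1 : ℂ) / 2 + ((ρ.im + v₀ : ℝ) : ℂ) * I) = ((m (ρ.im + v₀) : ℝ) : ℂ) :=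
    Mfun_half_eq_ofReal x (by linarith)
  have hM₁ : Mfun x.ψ ((1 : ℂ) / 2 + ((ρ.im + v₁ : ℝ) : ℂ) * I) = ((m (ρ.im + v₁) : ℝ) : ℂ) :=
    Mfun_half_eq_ofReal x (by linarith)
  have hM₂ : Mfun x.ψ ((1 : ℂ) / 2 + ((ρ.im + v₂ : ℝ) : ℂ) * I) = ((m (ρ.im + v₂) : ℝ) : ℂ) :=
    Mfun_half_eq_ofReal x (by linarith)
  have hq : Mfun x.ψ ((1 : ℂ) / 2 + ((ρ.im + v₀ : ℝ) : ℂ) * I) / (I * deriv (Mfun x.ψ) ρ)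
      = ((m (ρ.im + v₀) / r : ℝ) : ℂ) := by
    rw [hM₀, ← hd_def, hId]; push_cast; ring
  have hw : Mfun x.ψ ((1 : ℂ) / 2 + ((ρ.im + v₁ : ℝ) : ℂ) * I) *
      Mfun x.ψ ((1 : ℂ) / 2 + ((ρ.im + v₂ : ℝ) : ℂ) * I)
      = ((m (ρ.im + v₁) * m (ρ.im + v₂) : ℝ) : ℂ) := by
    rw [hM₁, hM₂]; push_cast; ring
  have hqpos : 0 < m (ρ.im + v₀) / r := by
    have : m (ρ.im + v₀) / r = r * m (ρ.im + v₀) / (r * r) := by field_simp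
    rw [this]
    exact div_pos hsign₀ (mul_self_pos.mpr hr0)
  rw [hq, hw, Complex.ofReal_im, Complex.ofReal_re, Complex.ofReal_im, Complex.ofReal_re]
  exact ⟨⟨rfl, hqpos⟩, rfl, hsign₁₂⟩

/-! ### Part 3 — shift data: heights `v_j = b_jα(1 + e_jc′α𝓛)` and the factorisation of `𝔠*_S` -/

end Setting

/-- **The height of the `j`-th shift of a shift datum**: `β_j = i·v_j` with `v_j = b_j α (1 + e_j c′ α 𝓛)`
(printed (2.13): `v = (α(1−5c′α𝓛), 2α(1+c′α𝓛), 3α(1−c′α𝓛))`). [cite: Zhang2022LandauSiegel, §2 (2.13)] -/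
def shiftHeight {k : ℕ} (S : ShiftData k) (c' : ℝ) (D : ℕ) (j : Fin k) : ℝ :=
  S.b j * alpha D * (1 + S.e j * c' * alpha D * ell D)

/-- `β_j = i·v_j`. [cite: Zhang2022LandauSiegel, §2 (2.13)] -/
theorem beta_eq_shiftHeight {k : ℕ} (S : ShiftData k) (c' : ℝ) (D : ℕ) (j : Fin k) :
    S.beta c' D j = ((shiftHeight S c' D j : ℝ) : ℂ) * I := by
  rw [ShiftData.beta, shiftHeight]
  push_cast
  ring

/-- For `ρ` on the critical line, `ρ + β_j = ½ + i(γ + v_j)`. [cite: Zhang2022LandauSiegel, §2 (2.13)] -/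
theorem add_beta_eq_shiftHeight {k : ℕ} (S : ShiftData k) (c' : ℝ) (D : ℕ) (j : Fin k) {ρ : ℂ}
    (hre : ρ.re = 1 / 2) :
    ρ + S.beta c' D j = (1 : ℂ) / 2 + ((ρ.im + shiftHeight S c' D j : ℝ) : ℂ) * I := by
  have hρeq : ρ = (1 : ℂ) / 2 + (ρ.im : ℂ) * I := Complex.ext (by simp [hre]) (by simp)
  rw [hρeq, beta_eq_shiftHeight]
  apply Complex.ext <;> simp

section Setting

variable {D : ℕ} [NeZero D] (χ : DirichletCharacter ℂ D)

omit [NeZero D] in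
/-- **`𝔠*_S(ρ,ψ) = [M(ρ+β₀)/(iM′(ρ))]·[M(ρ+β₁)M(ρ+β₂)]`** for a 3-shift datum (`−i/M′ = 1/(iM′)`; also when
`M′(ρ) = 0`, both sides being `0`) — the grouping of the proof of Lemma 2.3. [cite: Zhang2022LandauSiegel, §2 p. 5, proof of Lemma 2.3 p. 12] -/
theorem cstarS_eq_mul (S : ShiftData 3) (c' : ℝ) (x : Chr D) (ρ : ℂ) :
    cstarS S c' D x ρ = Mfun x.ψ (ρ + S.beta c' D 0) / (I * deriv (Mfun x.ψ) ρ) *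
      (Mfun x.ψ (ρ + S.beta c' D 1) * Mfun x.ψ (ρ + S.beta c' D 2)) := by
  rw [cstarS, Fin.prod_univ_three]
  rcases eq_or_ne (deriv (Mfun x.ψ) ρ) 0 with h0 | h0
  · rw [h0]; simp
  · rw [div_mul_eq_mul_div, div_eq_div_iff h0 (mul_ne_zero I_ne_zero h0)]
    linear_combination (-(Mfun x.ψ (ρ + S.beta c' D 0) * Mfun x.ψ (ρ + S.beta c' D 1) *
      Mfun x.ψ (ρ + S.beta c' D 2) * deriv (Mfun x.ψ) ρ)) * I_sq

/-- **`𝔠*_S(ρ,ψ)` is real and `≥ 0` at one zero, from Proposition 2.2 at one character, WHEN the three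
heights sit in the sign pattern** (`0 < v₀ ≤ α − c′α²𝓛`; `0 < v₁ ≤ v₂` in the shrunk `k`-th gap; all `< 2`):
the proof of Lemma 2.3 verbatim with `(β₁,β₂,β₃) ↦ (β₀,β₁,β₂)` of `S`. [cite: Zhang2022LandauSiegel, §2 proof of Lemma 2.3 pp. 11–12] -/
theorem cstarS_nonneg_of_prop22_heights (hD : 3 ≤ D) (hχ : χ.IsPrimitive) {c' : ℝ} (hc' : 0 ≤ c')
    (x : Chr D)
    (h_i : ∀ s ∈ prodZeroSetOmega χ x, s.re = 1 / 2)
    (h_ii : ∀ s ∈ prodZeroSetOmega χ x,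
      deriv (fun w => x.ψ.LFunction w * (psiChi χ x).LFunction w) s ≠ 0)
    (h_iii : ∀ s ∈ prodZeroSetOmega χ x, ∀ s' ∈ prodZeroSetOmega χ x, s.im < s'.im →
      (∀ s'' ∈ prodZeroSetOmega χ x, ¬ (s.im < s''.im ∧ s''.im < s'.im)) →
        |s'.im - s.im - alpha D| < c' * alpha D ^ 2 * ell D)
    (S : ShiftData 3) {k : ℕ}
    (hv₀ : 0 < shiftHeight S c' D 0) (hv₀' : shiftHeight S c' D 0 ≤ alpha D - c' * alpha D ^ 2 * ell D)
    (hv₀2 : shiftHeight S c' D 0 < 2)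
    (hv₁ : 0 < shiftHeight S c' D 1) (hk₁ : k * (alpha D + c' * alpha D ^ 2 * ell D) ≤ shiftHeight S c' D 1)
    (hv₁₂ : shiftHeight S c' D 1 ≤ shiftHeight S c' D 2)
    (hk₂ : shiftHeight S c' D 2 ≤ (k + 1) * (alpha D - c' * alpha D ^ 2 * ell D))
    (hv₂2 : shiftHeight S c' D 2 < 2)
    {ρ : ℂ} (hρ : ρ ∈ zeroSet D x) :
    (cstarS S c' D x ρ).im = 0 ∧ 0 ≤ (cstarS S c' D x ρ).re := by
  have hρS : ρ ∈ prodZeroSetOmega χ x := mem_prodZeroSetOmega_of_mem_zeroSet χ x hρ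
  have hre : ρ.re = 1 / 2 := h_i ρ hρS
  obtain ⟨⟨hqi, hqr⟩, hwi, hwr⟩ := M_signs_of_prop22_heights χ hD hχ hc' x h_i h_ii h_iii hρ
    hv₀ hv₀' hv₀2 hv₁ hk₁ hv₁₂ hk₂ hv₂2
  rw [cstarS_eq_mul, add_beta_eq_shiftHeight S c' D 0 hre, add_beta_eq_shiftHeight S c' D 1 hre,
    add_beta_eq_shiftHeight S c' D 2 hre]
  generalize Mfun x.ψ ((1 : ℂ) / 2 + ((ρ.im + shiftHeight S c' D 0 : ℝ) : ℂ) * I) /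
    (I * deriv (Mfun x.ψ) ρ) = q at hqi hqr ⊢
  generalize Mfun x.ψ ((1 : ℂ) / 2 + ((ρ.im + shiftHeight S c' D 1 : ℝ) : ℂ) * I) *
    Mfun x.ψ ((1 : ℂ) / 2 + ((ρ.im + shiftHeight S c' D 2 : ℝ) : ℂ) * I) = w at hwi hwr ⊢
  rw [Complex.mul_im, Complex.mul_re, hqi, hwi, mul_zero, zero_mul, add_zero, mul_zero, sub_zero]
  exact ⟨rfl, (mul_pos hqr hwr).le⟩

end Setting

/-! ### Part 4 — ROBUST sign-admissibility of a shift datum `(b, e)` and the thresholds it buys -/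

/-- **Robustly sign-admissible shift datum** `S = (b, e)` (`β_j = ib_jα(1 + e_jc′α𝓛)`): the main values `b` form a
sign-admissible triple (`Det.SignAdmissible`: `0 < b₀ < b₁ < b₂`, `b₀ ≤ 1`, `k ≤ b₁ < b₂ ≤ k+1`), AND whenever a
main value sits ON the `α`-fence (an integer) its first-order correction moves the shift off the fence into the gap
the sign pattern needs, by at least the accumulated gap error of Prop. 2.2 (iii): DOWN for the sub-first-gap shift
(`b₀ ∈ ℤ ⇒ e₀ ≤ −1`) and for the upper member of the pair (`b₂ ∈ ℤ ⇒ e₂ ≤ −1`), UP for the lower member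
(`b₁ ∈ ℤ ⇒ e₁ ≥ 1`). Off-lattice main values need nothing. Printed (2.13): `b = (1,2,3)`, `e = (−5, 1, −1)` — every
main value on the fence, corrections `(−5 ≤ −1, 1 ≥ 1, −1 ≤ −1)` (`signRobust_zhangShift`).
[cite: Zhang2022LandauSiegel, §2 (2.13), Lemma 2.3 and its proof pp. 11–12] -/
def SignRobust (S : ShiftData 3) : Prop :=
  SignAdmissible S.b ∧ (∀ n : ℕ, S.b 0 = n → S.e 0 ≤ -1) ∧ (∀ n : ℕ, S.b 1 = n → 1 ≤ S.e 1) ∧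
    (∀ n : ℕ, S.b 2 = n → S.e 2 ≤ -1)

/-- A robustly sign-admissible datum has sign-admissible main values. [cite: Zhang2022LandauSiegel, §2 (2.13)] -/
theorem SignRobust.signAdmissible {S : ShiftData 3} (h : SignRobust S) : SignAdmissible S.b := h.1

/-- An affine real function positive at `0` is positive near `0`. [folklore] -/
private theorem eventually_affine_pos {p q : ℝ} (hp : 0 < p) : ∀ᶠ t in 𝓝 (0 : ℝ), 0 < p + q * t := by
  have hc : Continuous fun t : ℝ => p + q * t := by fun_prop
  have ht : Tendsto (fun t : ℝ => p + q * t) (𝓝 0) (𝓝 p) := by simpa using hc.tendsto 0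
  exact ht.eventually_const_lt hp

/-- **The normalised sign-pattern inequalities hold for all small `t = c′α𝓛 ≥ 0`** when `S` is robustly
sign-admissible: with `ν_j(t) = b_j(1 + e_jt)` (so `v_j = α·ν_j(c′α𝓛)`) and the pair's gap index `k`, there is
`δ > 0` such that for `0 ≤ t < δ`: `0 < ν₀ ≤ 1 − t`, `0 < ν₁`, `k(1+t) ≤ ν₁ ≤ ν₂ ≤ (k+1)(1−t)`, and `t < 1`.
(Strict main-value inequalities persist for small `t`; on the fence the corrections give them for all `t ≥ 0`.)
[cite: Zhang2022LandauSiegel, §2 (2.13), proof of Lemma 2.3 pp. 11–12] -/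
theorem SignRobust.exists_threshold {S : ShiftData 3} (h : SignRobust S) :
    ∃ k : ℕ, ∃ δ : ℝ, 0 < δ ∧ ∀ t : ℝ, 0 ≤ t → t < δ →
      0 < S.b 0 * (1 + S.e 0 * t) ∧ S.b 0 * (1 + S.e 0 * t) ≤ 1 - t ∧
      0 < S.b 1 * (1 + S.e 1 * t) ∧ k * (1 + t) ≤ S.b 1 * (1 + S.e 1 * t) ∧
      S.b 1 * (1 + S.e 1 * t) ≤ S.b 2 * (1 + S.e 2 * t) ∧
      S.b 2 * (1 + S.e 2 * t) ≤ (k + 1) * (1 - t) ∧ t < 1 := by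
  obtain ⟨⟨hb0, hb01, hb12, hb0le, k, hk1, hk2⟩, he0, he1, he2⟩ := h
  refine ⟨k, ?_⟩
  have hb1 : 0 < S.b 1 := hb0.trans hb01
  have hb2 : 0 < S.b 2 := hb1.trans hb12
  -- each conjunct holds eventually in `𝓝[≥] 0`
  have c1 : ∀ᶠ t in 𝓝[Ici 0] (0 : ℝ), 0 < S.b 0 * (1 + S.e 0 * t) := by
    refine (eventually_affine_pos (q := S.b 0 * S.e 0) hb0).filter_mono nhdsWithin_le_nhds |>.mono ?_
    intro t ht; linarith
  have c2 : ∀ᶠ t in 𝓝[Ici 0] (0 : ℝ), S.b 0 * (1 + S.e 0 * t) ≤ 1 - t := by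
    rcases hb0le.lt_or_eq with hlt | heq
    · refine (eventually_affine_pos (q := -1 - S.b 0 * S.e 0) (sub_pos.mpr hlt)).filter_mono
        nhdsWithin_le_nhds |>.mono ?_
      intro t ht; linarith
    · have he : S.e 0 ≤ -1 := he0 1 (by rw [heq]; norm_num)
      refine eventually_nhdsWithin_of_forall fun t (ht : 0 ≤ t) => ?_
      rw [heq]; nlinarith
  have c3 : ∀ᶠ t in 𝓝[Ici 0] (0 : ℝ), 0 < S.b 1 * (1 + S.e 1 * t) := by
    refine (eventually_affine_pos (q := S.b 1 * S.e 1) hb1).filter_mono nhdsWithin_le_nhds |>.mono ?_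
    intro t ht; linarith
  have c4 : ∀ᶠ t in 𝓝[Ici 0] (0 : ℝ), k * (1 + t) ≤ S.b 1 * (1 + S.e 1 * t) := by
    rcases hk1.lt_or_eq with hlt | heq
    · refine (eventually_affine_pos (q := S.b 1 * S.e 1 - k) (sub_pos.mpr hlt)).filter_mono
        nhdsWithin_le_nhds |>.mono ?_
      intro t ht; linarith
    · have he : 1 ≤ S.e 1 := he1 k heq.symm
      refine eventually_nhdsWithin_of_forall fun t (ht : 0 ≤ t) => ?_
      rw [← heq]
      have hk0 : (0 : ℝ) ≤ k := k.cast_nonneg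
      have hid : (k : ℝ) * (1 + t) + k * t * (S.e 1 - 1) = k * (1 + S.e 1 * t) := by ring
      linarith [mul_nonneg (mul_nonneg hk0 ht) (sub_nonneg.mpr he)]
  have c5 : ∀ᶠ t in 𝓝[Ici 0] (0 : ℝ), S.b 1 * (1 + S.e 1 * t) ≤ S.b 2 * (1 + S.e 2 * t) := by
    refine (eventually_affine_pos (q := S.b 2 * S.e 2 - S.b 1 * S.e 1) (sub_pos.mpr hb12)).filter_mono
      nhdsWithin_le_nhds |>.mono ?_
    intro t ht; linarith
  have c6 : ∀ᶠ t in 𝓝[Ici 0] (0 : ℝ), S.b 2 * (1 + S.e 2 * t) ≤ (k + 1) * (1 - t) := by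
    rcases hk2.lt_or_eq with hlt | heq
    · refine (eventually_affine_pos (q := -(k + 1) - S.b 2 * S.e 2) (sub_pos.mpr hlt)).filter_mono
        nhdsWithin_le_nhds |>.mono ?_
      intro t ht; linarith
    · have he : S.e 2 ≤ -1 := he2 (k + 1) (by rw [heq]; push_cast; ring)
      refine eventually_nhdsWithin_of_forall fun t (ht : 0 ≤ t) => ?_
      rw [heq]
      have hk0 : (0 : ℝ) ≤ k := k.cast_nonneg
      have hid : ((k : ℝ) + 1) * (1 + S.e 2 * t) + (k + 1) * t * (-1 - S.e 2) = (k + 1) * (1 - t) := by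
        ring
      linarith [mul_nonneg (mul_nonneg (show (0 : ℝ) ≤ k + 1 by linarith) ht)
        (show (0 : ℝ) ≤ -1 - S.e 2 by linarith)]
  have c7 : ∀ᶠ t in 𝓝[Ici 0] (0 : ℝ), t < 1 :=
    mem_nhdsWithin_of_mem_nhds (Iio_mem_nhds zero_lt_one)
  obtain ⟨δ, hδ, hsub⟩ := Metric.mem_nhdsWithin_iff.mp
    ((((((c1.and c2).and c3).and c4).and c5).and c6).and c7)
  refine ⟨δ, hδ, fun t ht htδ => ?_⟩
  have hd : t ∈ Metric.ball (0 : ℝ) δ ∩ Ici 0 :=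
    ⟨by rw [Metric.mem_ball, dist_zero_right, Real.norm_of_nonneg ht]; exact htδ, ht⟩
  obtain ⟨⟨⟨⟨⟨⟨h1, h2⟩, h3⟩, h4⟩, h5⟩, h6⟩, h7⟩ := hsub hd
  exact ⟨h1, h2, h3, h4, h5, h6, h7⟩

/-- `L₀ ≤ log D` once `D ≥ ⌈exp L₀⌉₊`. [folklore] -/
private theorem le_ell_of_ceil_exp_le {L₀ : ℝ} {D : ℕ} (hD : ⌈Real.exp L₀⌉₊ ≤ D) : L₀ ≤ ell D := by
  have h : Real.exp L₀ ≤ D := le_trans (Nat.le_ceil _) (by exact_mod_cast hD)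
  exact (Real.le_log_iff_exp_le (lt_of_lt_of_le (Real.exp_pos _) h)).mpr h

/-- **"`D` sufficiently large" for a general shift datum**: `α = π/𝓛⁹ → 0` and `c′α𝓛 = c′π/𝓛⁸ → 0`, so for every
`δ > 0` both are `< δ` (and `D ≥ 3`) once `𝓛 ≥ max(2, (c′+1)π/δ + 1)`. [cite: Zhang2022LandauSiegel, §2 (2.6), (2.10)] -/
theorem exists_alpha_threshold {c' : ℝ} (hc' : 0 ≤ c') {δ : ℝ} (hδ : 0 < δ) :
    ∃ D₁ : ℕ, ∀ D : ℕ, D₁ ≤ D →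
      3 ≤ D ∧ 0 < alpha D ∧ alpha D < δ ∧ 0 ≤ c' * alpha D * ell D ∧ c' * alpha D * ell D < δ := by
  refine ⟨max 3 ⌈Real.exp (max 2 ((c' + 1) * π / δ + 1))⌉₊, fun D hD => ?_⟩
  have hD3 : 3 ≤ D := le_trans (le_max_left _ _) hD
  have hL := le_ell_of_ceil_exp_le (le_trans (le_max_right _ _) hD)
  have hℓ2 : 2 ≤ ell D := le_trans (le_max_left _ _) hL
  have hℓc : (c' + 1) * π / δ + 1 ≤ ell D := le_trans (le_max_right _ _) hL
  have hℓ0 : 0 < ell D := by linarith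
  have hα : alpha D = π / ell D ^ 9 := by rw [alpha, bigP, Real.log_exp]
  have hαpos : 0 < alpha D := by rw [hα]; positivity
  have hαℓ : alpha D * ell D = π / ell D ^ 8 := by
    rw [hα]; field_simp
  -- `π/𝓛⁹ ≤ π/𝓛⁸ ≤ π/𝓛 < δ/(c′+1) ≤ δ`
  have h8 : ell D ≤ ell D ^ 8 := le_self_pow₀ (by linarith) (by norm_num)
  have h89 : ell D ^ 8 ≤ ell D ^ 9 := pow_le_pow_right₀ (by linarith) (by norm_num)
  have hπℓ : (c' + 1) * π / ell D < δ := by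
    have h1 : (c' + 1) * π / δ < ell D := by linarith
    have h2 : (c' + 1) * π < ell D * δ := (div_lt_iff₀ hδ).mp h1
    rw [div_lt_iff₀ hℓ0]
    calc (c' + 1) * π < ell D * δ := h2
      _ = δ * ell D := mul_comm _ _
  have hkey : π / ell D ^ 8 < δ := by
    calc π / ell D ^ 8 ≤ π / ell D := by gcongr
      _ ≤ (c' + 1) * π / ell D := by
          rw [div_le_div_iff_of_pos_right hℓ0]; nlinarith [Real.pi_pos]
      _ < δ := hπℓ
  refine ⟨hD3, hαpos, ?_, by positivity, ?_⟩
  · calc alpha D = π / ell D ^ 9 := hα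
      _ ≤ π / ell D ^ 8 := by gcongr
      _ < δ := hkey
  · calc c' * alpha D * ell D = c' * (π / ell D ^ 8) := by rw [mul_assoc, hαℓ]
      _ ≤ (c' + 1) * (π / ell D ^ 8) := by gcongr; linarith
      _ < δ := by
          calc (c' + 1) * (π / ell D ^ 8) = (c' + 1) * π / ell D ^ 8 := by ring
            _ ≤ (c' + 1) * π / ell D := by gcongr
            _ < δ := hπℓ

/-- **The heights of a robust datum sit in the sign pattern for all large `D`**: eventually
`0 < v₀ ≤ α − c′α²𝓛`, `0 < v₁`, `k(α + c′α²𝓛) ≤ v₁ ≤ v₂ ≤ (k+1)(α − c′α²𝓛)`, all heights `< 2`, and `D ≥ 3`.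
[cite: Zhang2022LandauSiegel, §2 (2.13), proof of Lemma 2.3 pp. 11–12] -/
theorem SignRobust.exists_heights_threshold {S : ShiftData 3} (h : SignRobust S) {c' : ℝ} (hc' : 0 ≤ c') :
    ∃ k : ℕ, ∃ D₁ : ℕ, ∀ D : ℕ, D₁ ≤ D → 3 ≤ D ∧
      0 < shiftHeight S c' D 0 ∧ shiftHeight S c' D 0 ≤ alpha D - c' * alpha D ^ 2 * ell D ∧
      shiftHeight S c' D 0 < 2 ∧ 0 < shiftHeight S c' D 1 ∧
      k * (alpha D + c' * alpha D ^ 2 * ell D) ≤ shiftHeight S c' D 1 ∧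
      shiftHeight S c' D 1 ≤ shiftHeight S c' D 2 ∧
      shiftHeight S c' D 2 ≤ (k + 1) * (alpha D - c' * alpha D ^ 2 * ell D) ∧
      shiftHeight S c' D 2 < 2 := by
  obtain ⟨k, δ, hδ, hall⟩ := h.exists_threshold
  have hb2 : 0 < S.b 2 := (h.1.1.trans h.1.2.1).trans h.1.2.2.1
  -- the bound `B = b₂(1+|e₂|)` on `ν₂(t)` for `t < 1`, and the `α`-threshold `min δ (1/(B+1))`
  set B : ℝ := S.b 2 * (1 + |S.e 2|) with hB_def
  have hB0 : 0 ≤ B := by positivity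
  obtain ⟨D₁, hD₁⟩ := exists_alpha_threshold hc' (lt_min hδ (show 0 < 1 / (B + 1) by positivity))
  refine ⟨k, D₁, fun D hD => ?_⟩
  obtain ⟨hD3, hαpos, hαlt, ht0, htlt⟩ := hD₁ D hD
  have htδ : c' * alpha D * ell D < δ := lt_of_lt_of_le htlt (min_le_left _ _)
  have hαB : alpha D < 1 / (B + 1) := lt_of_lt_of_le hαlt (min_le_right _ _)
  obtain ⟨h1, h2, h3, h4, h5, h6, h7⟩ := hall (c' * alpha D * ell D) ht0 htδ
  set t : ℝ := c' * alpha D * ell D with ht_def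
  have hv : ∀ j : Fin 3, shiftHeight S c' D j = alpha D * (S.b j * (1 + S.e j * t)) := by
    intro j; rw [shiftHeight, ht_def]; ring
  have he : c' * alpha D ^ 2 * ell D = alpha D * t := by rw [ht_def]; ring
  have hν2B : S.b 2 * (1 + S.e 2 * t) ≤ B := by
    rw [hB_def]
    have : S.e 2 * t ≤ |S.e 2| := by
      calc S.e 2 * t ≤ |S.e 2| * t := by gcongr; exact le_abs_self _
        _ ≤ |S.e 2| * 1 := by gcongr
        _ = |S.e 2| := mul_one _
    nlinarith
  have hαB' : alpha D * B < 1 := by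
    calc alpha D * B ≤ alpha D * (B + 1) := by gcongr; linarith
      _ < 1 / (B + 1) * (B + 1) := by gcongr
      _ = 1 := by field_simp
  have hv2lt : shiftHeight S c' D 2 < 2 := by
    rw [hv 2]
    calc alpha D * (S.b 2 * (1 + S.e 2 * t)) ≤ alpha D * B := by gcongr
      _ < 2 := by linarith
  have hv12 : shiftHeight S c' D 1 ≤ shiftHeight S c' D 2 := by
    rw [hv 1, hv 2]; exact mul_le_mul_of_nonneg_left h5 hαpos.le
  have hv0le : shiftHeight S c' D 0 ≤ alpha D - c' * alpha D ^ 2 * ell D := by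
    rw [hv 0, he]; nlinarith
  have hαt : alpha D - c' * alpha D ^ 2 * ell D ≤ alpha D := by
    have : 0 ≤ c' * alpha D ^ 2 * ell D := by rw [he]; exact mul_nonneg hαpos.le ht0
    linarith
  refine ⟨hD3, ?_, hv0le, ?_, ?_, ?_, hv12, ?_, hv2lt⟩
  · rw [hv 0]; exact mul_pos hαpos h1
  · have h1B : 1 / (B + 1) ≤ 1 := by
      rw [div_le_one (show (0 : ℝ) < B + 1 by positivity)]
      linarith
    linarith [min_le_right δ (1 / (B + 1))]
  · rw [hv 1]; exact mul_pos hαpos h3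
  · rw [hv 1, he]; nlinarith
  · rw [hv 2, he]; nlinarith

section Setting

variable {D : ℕ} [NeZero D] (χ : DirichletCharacter ℂ D)

end Setting

/-! ### Part 5 — the registry row «SignLemma_S»: statement, deduction node, and DISCHARGE for robust data -/

/-- **«SignLemma_S» — Lemma 2.3 for a general 3-shift datum `S`** (the cell's registry row; REF-B2 e1): for all
large `D`, every real primitive `χ (mod D)`, every `ψ ∈ Ψ₁` and every sampled zero `ρ ∈ 𝔷(ψ)`, the shift weight
`𝔠*_S(ρ,ψ) = −iΠ_jM(ρ+β_j)/M′(ρ)` (`DetTemplate.cstarS`) is real and `≥ 0`. At `S = zhangShift` this IS the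
manuscript's Lemma 2.3 (`signLemmaS_zhangShift_iff`). A predicate ON the design (the hypothesis under which the
exact Cauchy–Schwarz (B1) `Det.norm_sq_discreteForm_le` applies to the `S`-detector) — stated here, and PROVED
below from Proposition 2.2 for every robustly sign-admissible `S` (`signLemmaS_of_prop22`); printed only at
`b = (1,2,3)`. [cite: Zhang2022LandauSiegel, §2 Lemma 2.3 p. 5, proof pp. 11–12] -/
def SignLemmaS (S : ShiftData 3) (c' : ℝ) : Prop :=
  ForAllLarge fun D _ χ => ∀ x ∈ PsiOne χ, ∀ ρ ∈ zeroSet D x,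
    (cstarS S c' D x ρ).im = 0 ∧ 0 ≤ (cstarS S c' D x ρ).re

/-- At the printed shift data «SignLemma_S» is the skeleton node `Lemma23 c′` verbatim.
[cite: Zhang2022LandauSiegel, §2 Lemma 2.3] -/
theorem signLemmaS_zhangShift_iff (c' : ℝ) : SignLemmaS zhangShift c' ↔ Skeleton.Lemma23 c' := by
  simp only [SignLemmaS, Skeleton.Lemma23, cstarS_zhang]

/-- **The deduction node «Prop. 2.2 ⇒ SignLemma_S»** (the general-`S` copy of the skeleton leaf `Ded23 c′`): the
shape in which the sign lemma of a shift design is consumed by the cell ((A) ⇒ Prop. 2.2 is the manuscript's §4;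
the step Prop. 2.2 ⇒ sign is the design's own obligation). [cite: Zhang2022LandauSiegel, §2 Lemma 2.3 (proof) pp. 11–12] -/
def DedSignLemmaS (S : ShiftData 3) (c' : ℝ) : Prop := Skeleton.Prop22 c' → SignLemmaS S c'

/-- At the printed shift data the deduction node is `Ded23 c′` verbatim. [cite: Zhang2022LandauSiegel, §2 Lemma 2.3] -/
theorem dedSignLemmaS_zhangShift_iff (c' : ℝ) : DedSignLemmaS zhangShift c' ↔ Skeleton.Ded23 c' := by
  rw [DedSignLemmaS, signLemmaS_zhangShift_iff]
  rfl

/-- **«SignLemma_S» PROVED from Proposition 2.2, for every robustly sign-admissible shift datum and every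
`c′ ≥ 0`** — the manuscript's proof of Lemma 2.3 run at general heights: for `D` large (depending on `S`, `c′`)
the three heights `v_j = b_jα(1 + e_jc′α𝓛)` sit in the sign pattern (`SignRobust.exists_heights_threshold`),
Prop. 2.2 (i)–(iii) at `ψ` make `(Im ρ, Im ρ + v₀]` and `[Im ρ + v₁, Im ρ + v₂]` zero-free for the real continuous
`u ↦ M(½+iu,ψ)` (`Mfun_half_ne_zero_of_gap_nat`), and the two sign steps give `𝔠*_S(ρ,ψ) ≥ 0`
(`cstarS_nonneg_of_prop22_heights`). [cite: Zhang2022LandauSiegel, §2 Lemma 2.3 (proof) pp. 11–12, (2.13)] -/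
theorem signLemmaS_of_prop22 {S : ShiftData 3} (hS : SignRobust S) {c' : ℝ} (hc' : 0 ≤ c')
    (h22 : Skeleton.Prop22 c') : SignLemmaS S c' := by
  obtain ⟨k, D₁, hD₁⟩ := hS.exists_heights_threshold hc'
  obtain ⟨h_i, h_ii, h_iii⟩ := h22
  obtain ⟨D₂, h⟩ := (h_i.and h_ii).and h_iii
  refine ⟨max D₁ D₂, fun D _ χ hD hq hp => ?_⟩
  obtain ⟨hD3, hv₀, hv₀', hv₀2, hv₁, hk₁, hv₁₂, hk₂, hv₂2⟩ := hD₁ D (le_trans (le_max_left _ _) hD)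
  obtain ⟨⟨h1, h2⟩, h3⟩ := h D χ (le_trans (le_max_right _ _) hD) hq hp
  intro x hx ρ hρ
  exact cstarS_nonneg_of_prop22_heights χ hD3 hp hc' x (h1 x hx) (h2 x hx) (h3 x hx) S hv₀ hv₀' hv₀2
    hv₁ hk₁ hv₁₂ hk₂ hv₂2 hρ

/-- **The deduction node «Prop. 2.2 ⇒ SignLemma_S» HOLDS for robust data, `c′ ≥ 0`** (general-`S` `ded23_holds`).
[cite: Zhang2022LandauSiegel, §2 Lemma 2.3 (proof) pp. 11–12] -/
theorem dedSignLemmaS_holds {S : ShiftData 3} (hS : SignRobust S) {c' : ℝ} (hc' : 0 ≤ c') :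
    DedSignLemmaS S c' :=
  signLemmaS_of_prop22 hS hc'

/-- **A shift detector whose sign lemma holds is `Positive`** (given Prop. 2.2 (i) for the weight `ω`): `𝔠*_S ≥ 0`
real, the sampled zeros are on the critical line, and `ω(½+it) > 0` ((2.15)), so the weight `𝔠*_S(ρ,ψ)ω(ρ)` of
`shiftDetector S c′` is real and `≥ 0` at every sampled pair — the (2.16)/(B1) input `Detector.Positive`.
[cite: Zhang2022LandauSiegel, §2 Lemma 2.3, (2.15)–(2.16)] -/
theorem positive_shiftDetector_of_signLemmaS {S : ShiftData 3} {c' : ℝ} (h : SignLemmaS S c')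
    (h22i : Skeleton.Prop22i) : (shiftDetector S c').Positive := by
  have h2 : ForAllLarge fun D _ _ => 0 < ell2 D :=
    ForAllLarge.of_le 2 fun D _ _ hD _ _ => ell2_pos hD
  refine ((h.and h22i).and h2).mono ?_
  intro D _ χ _ _ h x hx ρ hρ
  obtain ⟨⟨hL, hP22⟩, hℓ2⟩ := h
  obtain ⟨him, hre⟩ := hL x hx ρ hρ
  have hline : ρ.re = 1 / 2 := hP22 x hx ρ (mem_prodZeroSetOmega_of_mem_zeroSet χ x hρ)
  obtain ⟨hωre, hωim⟩ := SmoothWeight.omega_re_pos_of_re_eq_half hℓ2 (t0 D) hline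
  simp only [shiftDetector, Skeleton.omegaW]
  refine ⟨?_, ?_⟩
  · rw [Complex.mul_im, him, hωim]; ring
  · rw [Complex.mul_re, him, hωim, mul_zero, sub_zero]
    exact mul_nonneg hre hωre.le

/-- **Every robustly sign-admissible shift detector is `Positive`, given Proposition 2.2** (`c′ ≥ 0`): the sign
input of the exact Cauchy–Schwarz / (2.16) for the whole family of W2 shift designs, as a theorem rather than a
per-design hypothesis. [cite: Zhang2022LandauSiegel, §2 Lemma 2.3, (2.15)–(2.16)] -/
theorem positive_shiftDetector {S : ShiftData 3} (hS : SignRobust S) {c' : ℝ} (hc' : 0 ≤ c')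
    (h22 : Skeleton.Prop22 c') : (shiftDetector S c').Positive :=
  positive_shiftDetector_of_signLemmaS (signLemmaS_of_prop22 hS hc' h22) h22.1

/-- … hence its discrete mean squares are non-negative reals for all large `D` ((2.16) for the `S`-detector).
[cite: Zhang2022LandauSiegel, §2 (2.16)] -/
theorem ineq216_shiftDetector {S : ShiftData 3} (hS : SignRobust S) {c' : ℝ} (hc' : 0 ≤ c')
    (h22 : Skeleton.Prop22 c') :
    ForAllLarge fun D _ χ => ∀ F : Chr D → ℂ → ℂ,
      0 ≤ ((shiftDetector S c').mean χ fun x ρ => F x ρ * (starRingEnd ℂ) (F x ρ)).re ∧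
        ((shiftDetector S c').mean χ fun x ρ => F x ρ * (starRingEnd ℂ) (F x ρ)).im = 0 :=
  (positive_shiftDetector hS hc' h22).ineq216

/-! ### Part 6 — instances: the printed datum, lattice and off-lattice probes, and a non-robust reading -/

/-- A fraction `r/q` in which `q ∤ r` is not (the cast of) a natural number. [folklore] -/
private theorem nat_cast_ne_of_mul {q : ℕ} {r : ℕ} (hq : 0 < q) (hr : ¬ q ∣ r) (n : ℕ) :
    ((r : ℝ) / q : ℝ) ≠ (n : ℝ) := by
  intro h
  rw [div_eq_iff (by exact_mod_cast hq.ne')] at h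
  have h' : r = n * q := by exact_mod_cast h
  exact hr ⟨n, by rw [h', mul_comm]⟩

/-- **The printed shift datum (2.13) is robustly sign-admissible**: `b = (1,2,3)` all on the fence, corrections
`e = (−5, 1, −1)` with `−5 ≤ −1`, `1 ≥ 1`, `−1 ≤ −1` (the last two exactly at the margin the proof needs).
[cite: Zhang2022LandauSiegel, §2 (2.13), proof of Lemma 2.3 p. 11] -/
theorem signRobust_zhangShift : SignRobust zhangShift := by
  refine ⟨signAdmissible_std, fun n _ => ?_, fun n _ => ?_, fun n _ => ?_⟩
  · simp [zhangShift]
  · simp [zhangShift]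
  · show (![-5, 1, -1] : Fin 3 → ℝ) 2 ≤ -1
    simp

/-- CONSISTENCY CHECK: along the general route the manuscript's own detector is `Positive` given Prop. 2.2
(`shiftDetector zhangShift = zhang`; compare `DetTemplate.positive_zhang` ∘ `Skeleton.ded23_holds`).
[cite: Zhang2022LandauSiegel, §2 Lemma 2.3, (2.16)] -/
theorem positive_zhang_of_prop22 {c' : ℝ} (hc' : 0 ≤ c') (h22 : Skeleton.Prop22 c') :
    (DetTemplate.zhang c').Positive := by
  rw [← shiftDetector_zhang]
  exact positive_shiftDetector signRobust_zhangShift hc' h22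

/-- The lattice probe `b = (1,3,4)` (cell triple; `Det.signAdmissible_134`) with the printed-style corrections
`e = (−5, 1, −1)` is robust. [cite: Zhang2022LandauSiegel, §2 (2.13), Lemma 2.3] -/
theorem signRobust_134 : SignRobust ⟨![1, 3, 4], ![-5, 1, -1]⟩ := by
  refine ⟨signAdmissible_134, fun n _ => ?_, fun n _ => ?_, fun n _ => ?_⟩
  · simp
  · simp
  · show (![-5, 1, -1] : Fin 3 → ℝ) 2 ≤ -1
    simp

/-- The probe `b = (½,2,3)` (`Det.signAdmissible_half23`): the off-lattice `b₀ = ½` needs no correction, the fence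
pair `(2,3)` needs `e₁ ≥ 1`, `e₂ ≤ −1`; so `e = (0, 1, −1)` is robust. [cite: Zhang2022LandauSiegel, §2 (2.13), Lemma 2.3] -/
theorem signRobust_half23 : SignRobust ⟨![1 / 2, 2, 3], ![0, 1, -1]⟩ := by
  refine ⟨signAdmissible_half23, fun n hn => ?_, fun n _ => ?_, fun n _ => ?_⟩
  · exact absurd hn (by simpa using nat_cast_ne_of_mul (q := 2) (r := 1) (by norm_num) (by norm_num) n)
  · simp
  · show (![0, 1, -1] : Fin 3 → ℝ) 2 ≤ -1
    simp

/-- `(½; 23/10, 27/10)` — an off-lattice admissible triple (the §E slice's box witness) — is robust with NO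
corrections at all (`e = 0`): only fence values need first-order care. [cite: Zhang2022LandauSiegel, §2 (2.13), Lemma 2.3] -/
theorem signRobust_offLattice : SignRobust ⟨![1 / 2, 23 / 10, 27 / 10], ![0, 0, 0]⟩ := by
  refine ⟨?_, fun n hn => ?_, fun n hn => ?_, fun n hn => ?_⟩
  · refine ⟨by norm_num [Matrix.cons_val_zero], by norm_num [Matrix.cons_val_zero, Matrix.cons_val_one, Matrix.head_cons],
      by norm_num [Matrix.cons_val_one, Matrix.cons_val_two, Matrix.head_cons, Matrix.tail_cons],
      by norm_num [Matrix.cons_val_zero], 2,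
      by norm_num [Matrix.cons_val_one, Matrix.head_cons],
      by norm_num [Matrix.cons_val_two, Matrix.head_cons, Matrix.tail_cons]⟩
  · exact absurd hn (by simpa using nat_cast_ne_of_mul (q := 2) (r := 1) (by norm_num) (by norm_num) n)
  · exact absurd hn (by simpa using nat_cast_ne_of_mul (q := 10) (r := 23) (by norm_num) (by norm_num) n)
  · exact absurd hn (by
      simpa [Matrix.cons_val_two, Matrix.tail_cons, Matrix.head_cons] using
        nat_cast_ne_of_mul (q := 10) (r := 27) (by norm_num) (by norm_num) n)

/-- **The printed MAIN VALUES WITHOUT the printed corrections are NOT robust**: `b = (1,2,3)` with `e = 0` puts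
all three shifts exactly on the fence, where Prop. 2.2 (iii)'s `O(α²𝓛)` gap error decides nothing — the
corrections `(−5, 1, −1)` of (2.13) are what the proof uses, and `SignRobust` records exactly that.
[cite: Zhang2022LandauSiegel, §2 (2.13), proof of Lemma 2.3 p. 11] -/
theorem not_signRobust_std_uncorrected : ¬ SignRobust ⟨![1, 2, 3], ![0, 0, 0]⟩ := by
  intro h
  have h0 := h.2.1 1 (by simp)
  simp at h0
  linarith

/-! ### Part 7 — canonical corrections: every sign-admissible triple of MAIN VALUES carries a robust datum -/

/-- **The canonical first-order corrections `e = (−1, 1, −1)` make EVERY sign-admissible triple of main values a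
robustly sign-admissible datum** (the three fence conditions hold with equality-type margins whatever `b` is; the
printed (2.13) uses `(−5, 1, −1)`). So a class sentence quantified over admissible MAIN VALUES `b` can discharge the
sign input by choosing these corrections. [cite: Zhang2022LandauSiegel, §2 (2.13), proof of Lemma 2.3 p. 11] -/
theorem signRobust_of_signAdmissible {b : Fin 3 → ℝ} (h : SignAdmissible b) :
    SignRobust ⟨b, ![-1, 1, -1]⟩ := by
  refine ⟨h, fun n _ => ?_, fun n _ => ?_, fun n _ => ?_⟩
  · simp
  · simp
  · show (![-1, 1, -1] : Fin 3 → ℝ) 2 ≤ -1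
    simp

/-- **Hence: for every sign-admissible triple `b` and `c′ ≥ 0`, Proposition 2.2 gives the sign lemma of the shift
detector with data `(b; −1, 1, −1)`.** [cite: Zhang2022LandauSiegel, §2 Lemma 2.3 (proof) pp. 11–12, (2.13)] -/
theorem signLemmaS_of_signAdmissible {b : Fin 3 → ℝ} (h : SignAdmissible b) {c' : ℝ} (hc' : 0 ≤ c')
    (h22 : Skeleton.Prop22 c') : SignLemmaS ⟨b, ![-1, 1, -1]⟩ c' :=
  signLemmaS_of_prop22 (signRobust_of_signAdmissible h) hc' h22

/-- … and that detector is `Positive` (the (2.16)/(B1) input), given Proposition 2.2.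
[cite: Zhang2022LandauSiegel, §2 Lemma 2.3, (2.15)–(2.16)] -/
theorem positive_shiftDetector_of_signAdmissible {b : Fin 3 → ℝ} (h : SignAdmissible b) {c' : ℝ}
    (hc' : 0 ≤ c') (h22 : Skeleton.Prop22 c') : (shiftDetector ⟨b, ![-1, 1, -1]⟩ c').Positive :=
  positive_shiftDetector (signRobust_of_signAdmissible h) hc' h22

end Det

end Literature.NumberTheory.LFunctions.Zhang2022
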